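import Summits.Schanuel.Schanuel.Theorems.ZilberEacPlaceAlgebraic
import Summits.Schanuel.Schanuel.Theorems.ZilberEacLindemannNonResonance
import Summits.Schanuel.Schanuel.Theorems.ZilberEacTransportedKronecker
import Summits.Schanuel.Schanuel.Theorems.ZilberEacIrrationalDirectionAll
import Summits.Schanuel.Schanuel.Theorems.ZilberEacFastPoleFibre
import Summits.Schanuel.Schanuel.Theorems.ZilberEacRationalAsymptoteNotLine
import Mathlib.Topology.Algebra.Polynomial
import HarnessLib

/-!
# Arbitrary base branches, LXXXIII: EVERY unbounded place of a curve over `ℚ̄` — the assembly of the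
# engines along one place (any fibre value)

HONEST FRAMING.  Cell `pub-schanuel` (Zilber's Exponential-Algebraic Closedness, case ladder;
host summit Schanuel), seat 2, gen 32.  Step E5 (germ level) of the roadmap.  `F ∈ ℂ[x₀][x₁]`
irreducible, containing no line (`x₁`-degree `≥ 2`, or a rational graph), with ALGEBRAIC
coefficients; an unbounded place `x₀ = s^{-k}`, `x₁ = Φ(s)s^{-M}` (`k, M ≥ 1`, `Φ(0) ≠ 0`) — then
`Φ(0) ∈ ℚ̄` (file LXXXI); a fibre
value `ψ(s)s^L` (`ψ(0) ≠ 0`, any `L`); `S` irreducible of dimension `≤ 2` containing the germ.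
**`unprojectedDense_branch_of_algebraicCurve`**: `I(S ∩ Γ_exp) = I(S)`, by cases:
`M < k` — slow regime, non-resonant by Lindemann (files LXXVIII, LXXXII); `M > k` — fast regime:
pole fibres unconditionally (file LXXX(c)), unit fibres by growth/Kronecker (LXXII + LXXXII);
`M = k`: `Im Φ(0) ≠ 0` — growth (XXXII); `Φ(0)` real irrational — LXXV; `Φ(0) = q ∈ ℚ` — shear by
`U = (a′ b′; −num q, den q)`: `den·Φ − num ≡ 0` is impossible (the curve would contain the line
`x₁ = qx₀`), so `den(Φ(s) − q) = s^m·γ(s)`, `γ(0) ≠ 0`: `m ≥ k` — a rational asymptote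
(LXVIII(b)); `m < k` — a slow sheared coordinate whose leading coefficient `γ(0)` is algebraic (file
LXXXI applied to the transported curve `F(x₀, y + qx₀)`) hence non-resonant (LXXXII): file LXXIX.
(**`unprojectedDense_branch_rationalDirection`**.)  Decided instances of an OPEN question
(Mantova–Masser, PLMS 2024 §1 p. 5); EC(3,2) OPEN; NOT Schanuel's conjecture (neither used nor
implied; Lindemann's theorem is); EAC ⇏ SC.
-/

noncomputable section

open Filter Topology Set Complex Polynomial
open Literature.NumberTheory.Transcendental Literature.ModelTheory.Zilber
open Literature.ModelTheory.ExponentialFields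

set_option linter.dupNamespace false

namespace Summit.Schanuel.Schanuel.Theorems

section AlgebraicBranch

variable (F : ℂ[X][X])

/-- The curve does not contain the line `x₁ = q x₀`: `F((s^k)⁻¹, q (s^k)⁻¹) = 0` near `s = 0` is
impossible when `C` contains no line `m₀x₀ + m₁x₁ = a`, `m₁ ≠ 0` (hypothesis `hnc`; automatic in
`x₁`-degree `≥ 2`, `planeCurve_not_contains_line`, and for rational graphs, file LXXXVII(a)).
[folklore] -/
theorem not_eventually_line_place
    (hnc : ∀ m₀ m₁ a : ℂ, m₁ ≠ 0 →
      ∃ x₀ : ℂ, (F.map (Polynomial.evalRingHom x₀)).eval ((a - m₀ * x₀) / m₁) ≠ 0) (q : ℂ) {k : ℕ}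
    (hk : 1 ≤ k) :
    ¬ ∀ᶠ s in 𝓝[≠] (0 : ℂ),
      (F.map (Polynomial.evalRingHom (s ^ k)⁻¹)).eval (q * (s ^ k)⁻¹) = 0 := by
  intro hline
  set h : ℂ[X] := F.eval (Polynomial.C q * X) with hh
  have hev : ∀ x : ℂ, h.eval x = (F.map (Polynomial.evalRingHom x)).eval (q * x) := by
    intro x
    rw [hh, ← Polynomial.coe_evalRingHom, Polynomial.eval, Polynomial.hom_eval₂, Polynomial.eval_map]
    simp
  -- `h` is not the zero polynomial (the curve contains no line)
  have hne : h ≠ 0 := by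
    intro h0
    obtain ⟨x₀, hx₀⟩ := hnc (-q) 1 0 one_ne_zero
    apply hx₀
    have := hev x₀
    rw [h0, Polynomial.eval_zero] at this
    rw [show ((0 : ℂ) - -q * x₀) / 1 = q * x₀ by ring]
    exact this.symm
  have hk0 : k ≠ 0 := by omega
  have hnorm : Tendsto (fun s : ℂ => ‖(s ^ k)⁻¹‖) (𝓝[≠] (0 : ℂ)) atTop := by
    have h1 : Tendsto (fun s : ℂ => s ^ k) (𝓝[≠] (0 : ℂ)) (𝓝 0) := by
      have h := (continuous_pow k (M := ℂ)).tendsto (0 : ℂ)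
      rw [zero_pow hk0] at h
      exact h.mono_left (nhdsWithin_le_nhds (s := {(0 : ℂ)}ᶜ))
    have h2 : Tendsto (fun s : ℂ => s ^ k) (𝓝[≠] (0 : ℂ)) (𝓝[≠] 0) :=
      tendsto_nhdsWithin_iff.2 ⟨h1, eventually_nhdsWithin_of_forall fun s hs => pow_ne_zero _ hs⟩
    have h3 : Tendsto (fun s : ℂ => ‖s ^ k‖⁻¹) (𝓝[≠] (0 : ℂ)) atTop :=
      (tendsto_norm_nhdsNE_zero.comp h2).inv_tendsto_nhdsGT_zero
    refine h3.congr fun s => ?_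
    simp [norm_inv]
  by_cases hdeg : 0 < h.degree
  · have hgrow := Polynomial.tendsto_norm_atTop h hdeg hnorm
    have hev0 : ∀ᶠ s in 𝓝[≠] (0 : ℂ), ‖h.eval (s ^ k)⁻¹‖ = 0 := by
      filter_upwards [hline] with s hs
      rw [hev, hs, norm_zero]
    obtain ⟨s, hs1, hs2⟩ := ((hgrow.eventually (eventually_gt_atTop 0)).and hev0).exists
    exact (lt_irrefl (0 : ℝ)) (by rwa [hs2] at hs1)
  · -- `h` constant nonzero
    have hd0 : h.degree ≤ 0 := not_lt.1 hdeg
    have hc : h = Polynomial.C (h.coeff 0) := Polynomial.eq_C_of_degree_le_zero hd0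
    have hc0 : h.coeff 0 ≠ 0 := fun h0 => hne (by rw [hc, h0, map_zero])
    obtain ⟨s, hs⟩ := hline.exists
    have := hev (s ^ k)⁻¹
    rw [hs, hc, Polynomial.eval_C] at this
    exact hc0 this

/-- **Rational equal-order direction, over `ℚ̄`: dense.**  `F` irreducible containing no line, with
algebraic coefficients; a place `x₀ = s^{-k}`, `x₁ = Φ(s)s^{-k}` with `Φ(0) = q ∈ ℚ`; any fibre value
`ψ(s)s^L`; `S` irreducible of dimension `≤ 2` containing the germ.
[cite: MantovaMasser2023, §1 Further remarks, p. 5 (the question, open in general)] (new) -/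
theorem unprojectedDense_branch_rationalDirection {S : Set (Fin 2 ⊕ Fin 2 → ℂ)}
    (hS : IsIrreducibleClosed ℂ S) (hdim : zariskiDim ℂ S ≤ (2 : ℕ)) (hFirr : Irreducible F)
    (hnc : ∀ m₀ m₁ a : ℂ, m₁ ≠ 0 →
      ∃ x₀ : ℂ, (F.map (Polynomial.evalRingHom x₀)).eval ((a - m₀ * x₀) / m₁) ≠ 0)
    (halg : ∀ i j, IsAlgebraic ℚ ((F.coeff j).coeff i))
    {k : ℕ} (hk : 1 ≤ k) {Φ : ℂ → ℂ} (hΦ : AnalyticAt ℂ Φ 0) (q : ℚ) (hΦq : Φ 0 = (q : ℂ))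
    (hplace : ∀ᶠ s in 𝓝[≠] (0 : ℂ),
      (F.map (Polynomial.evalRingHom (s ^ k)⁻¹)).eval (Φ s * (s ^ k)⁻¹) = 0)
    (L : ℤ) {ψ : ℂ → ℂ} (hψ : AnalyticAt ℂ ψ 0) (hψ0 : ψ 0 ≠ 0)
    (hgerm : ∀ᶠ s in 𝓝[≠] (0 : ℂ),
      (Sum.elim ![(s ^ k)⁻¹, Φ s * (s ^ k)⁻¹] ![ψ s * s ^ L, Complex.exp (Φ s * (s ^ k)⁻¹)] :
        Fin 2 ⊕ Fin 2 → ℂ) ∈ S) :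
    UnprojectedDense S := by
  classical
  -- the shear `U = (a' b'; -num, den)`, `a' den + b' num = 1`
  obtain ⟨num, hnum⟩ : ∃ num : ℤ, num = q.num := ⟨_, rfl⟩
  obtain ⟨den, hden⟩ : ∃ den : ℕ, den = q.den := ⟨_, rfl⟩
  have hden0 : (den : ℂ) ≠ 0 := by rw [hden]; exact_mod_cast q.den_nz
  have hdenz : den ≠ 0 := by rw [hden]; exact q.den_nz
  have hqC : (q : ℂ) = (num : ℂ) / (den : ℂ) := by
    rw [hnum, hden]; exact_mod_cast (Rat.cast_def q : (q : ℂ) = _)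
  have hcop : IsCoprime num (den : ℤ) := by
    rw [Int.isCoprime_iff_gcd_eq_one, hnum, hden]
    exact q.reduced
  obtain ⟨b', a', hbez⟩ := hcop
  have e1 : a' * (den : ℤ) + b' * num = 1 := by linear_combination hbez
  have e2 : num * b' + (den : ℤ) * a' = 1 := by linear_combination hbez
  have e3 : (den : ℤ) * a' + b' * num = 1 := by linear_combination hbez
  have e4 : num * b' + a' * (den : ℤ) = 1 := by linear_combination hbez
  set U : Matrix (Fin 2) (Fin 2) ℤ := !![a', b'; -num, den] with hU
  set V : Matrix (Fin 2) (Fin 2) ℤ := !![(den : ℤ), -b'; num, a'] with hV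
  have hUV : U * V = 1 := by
    ext i j
    fin_cases i <;> fin_cases j <;>
      simp [hU, hV, Matrix.mul_apply, Fin.sum_univ_two, e1, e2] <;> ring
  have hVU : V * U = 1 := by
    ext i j
    fin_cases i <;> fin_cases j <;>
      simp [hU, hV, Matrix.mul_apply, Fin.sum_univ_two, e3, e4] <;> ring
  -- the sheared analytic function `den·Φ − num`
  set Gs : ℂ → ℂ := fun s => (den : ℂ) * Φ s - num with hGs
  have hGsan : AnalyticAt ℂ Gs 0 := (analyticAt_const.mul hΦ).sub analyticAt_const
  have hGs0 : Gs 0 = 0 := by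
    simp only [hGs, hΦq, hqC]
    field_simp
    ring
  have hX₁ : ∀ s : ℂ, (U 1 0 : ℂ) * (s ^ k)⁻¹ + (U 1 1 : ℂ) * (Φ s * (s ^ k)⁻¹) = Gs s * (s ^ k)⁻¹ := by
    intro s
    simp [hU, hGs]
    ring
  have hgermX : ∀ᶠ s in 𝓝[≠] (0 : ℂ),
      (Sum.elim ![(s ^ k)⁻¹, (fun s => Φ s * (s ^ k)⁻¹) s]
        ![ψ s * s ^ L, Complex.exp ((fun s => Φ s * (s ^ k)⁻¹) s)] : Fin 2 ⊕ Fin 2 → ℂ) ∈ S := hgerm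
  by_cases hzero : ∀ᶠ s in 𝓝 (0 : ℂ), Gs s = 0
  · -- the curve would contain the line `x₁ = q x₀`
    exfalso
    refine not_eventually_line_place F hnc (q : ℂ) hk ?_
    filter_upwards [hplace, eventually_nhdsWithin_of_eventually_nhds hzero] with s hs hG
    have hΦs : Φ s = (q : ℂ) := by
      simp only [hGs, sub_eq_zero] at hG
      rw [hqC, eq_div_iff hden0, mul_comm]
      exact hG
    rwa [hΦs] at hs
  · obtain ⟨m, γ, hγan, hγ0, hfac⟩ := (hGsan.exists_eventuallyEq_pow_smul_nonzero_iff).2 hzero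
    have hm1 : 1 ≤ m := by
      by_contra hm0
      have hm0' : m = 0 := by omega
      have h := hfac.self_of_nhds
      rw [hm0', pow_zero, one_smul, hGs0] at h
      exact hγ0 h.symm
    have hfac' : ∀ᶠ s in 𝓝[≠] (0 : ℂ), Gs s = s ^ m * γ s := by
      filter_upwards [eventually_nhdsWithin_of_eventually_nhds hfac] with s hs
      rw [hs, sub_zero, smul_eq_mul]
    by_cases hmk : k ≤ m
    · -- bounded sheared coordinate: a rational asymptote (file LXVIII(b))
      refine unprojectedDense_rationalAsymptote_of_notLine F hS hdim hFirr hnc U V hUV hVU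
        (by simp [hU]; exact_mod_cast hdenz) hk (X₁ := fun s => Φ s * (s ^ k)⁻¹)
        (γ := fun s => s ^ (m - k) * γ s) ((analyticAt_id.pow _).mul hγan) ?_ hplace L hψ hψ0 hgermX
      filter_upwards [hfac', self_mem_nhdsWithin] with s hs (hs0 : s ≠ 0)
      rw [hX₁ s, hs, show s ^ m = s ^ (m - k) * s ^ k by rw [← pow_add, Nat.sub_add_cancel hmk]]
      field_simp
    · -- slow sheared coordinate of order `M' = k − m`; its leading coefficient is algebraic
      have hmk' : m < k := by omega
      set M' : ℕ := k - m with hM'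
      have hM'1 : 1 ≤ M' := by omega
      have hM'k : M' < k := by omega
      have hγ' : ∀ᶠ s in 𝓝[≠] (0 : ℂ), (U 1 0 : ℂ) * (s ^ k)⁻¹ + (U 1 1 : ℂ) *
          ((fun s => Φ s * (s ^ k)⁻¹) s) = γ s * (s ^ M')⁻¹ := by
        filter_upwards [hfac', self_mem_nhdsWithin] with s hs (hs0 : s ≠ 0)
        rw [hX₁ s, hs, show s ^ k = s ^ m * s ^ M' by rw [← pow_add, Nat.add_sub_cancel' hmk'.le]]
        field_simp
      -- the transported curve `G(x₀, y) = F(x₀, (y + num·x₀)/den)` has algebraic coefficients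
      set A := algebraicClosure ℚ ℂ with hA
      have hrows : ∀ j, F.coeff j ∈ Polynomial.lifts (algebraMap A ℂ) := by
        intro j
        rw [Polynomial.lifts_iff_coeff_lifts]
        intro i
        exact ⟨⟨(F.coeff j).coeff i, mem_algebraicClosure_iff.2 (halg i j)⟩, rfl⟩
      have hlift : F ∈ Polynomial.lifts (Polynomial.mapRingHom (algebraMap A ℂ)) := by
        rw [Polynomial.lifts_iff_coeff_lifts]
        intro j
        obtain ⟨r, hr⟩ := (Polynomial.mem_lifts _).1 (hrows j)
        exact ⟨r, hr⟩
      obtain ⟨F₀, hF₀⟩ := (Polynomial.mem_lifts _).1 hlift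
      set P₀ : Polynomial (Polynomial A) :=
        Polynomial.C (Polynomial.C ((den : A)⁻¹)) * (X + Polynomial.C (Polynomial.C (num : A) * X))
        with hP₀
      set P : ℂ[X][X] := Polynomial.C (Polynomial.C ((den : ℂ)⁻¹)) *
        (X + Polynomial.C (Polynomial.C (num : ℂ) * X)) with hP
      have hPmap : P₀.map (Polynomial.mapRingHom (algebraMap A ℂ)) = P := by
        simp [hP₀, hP, Polynomial.map_mul, Polynomial.map_add]
      set G : ℂ[X][X] := F.comp P with hG
      have hGmap : (F₀.comp P₀).map (Polynomial.mapRingHom (algebraMap A ℂ)) = G := by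
        rw [Polynomial.map_comp, hF₀, hPmap]
      have halgG : ∀ i j, IsAlgebraic ℚ ((G.coeff j).coeff i) := by
        intro i j
        rw [← hGmap, Polynomial.coeff_map, Polynomial.coe_mapRingHom, Polynomial.coeff_map]
        exact mem_algebraicClosure_iff.1 (((F₀.comp P₀).coeff j).coeff i).2
      have hF0 : F ≠ 0 := hFirr.ne_zero
      have hPdeg : P.natDegree = 1 := by
        rw [hP]
        have h1 : (X + Polynomial.C (Polynomial.C (num : ℂ) * X) : ℂ[X][X]).natDegree = 1 :=
          Polynomial.natDegree_X_add_C _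
        rw [Polynomial.natDegree_C_mul (by simp [hden0]), h1]
      have hG0 : G ≠ 0 := by
        rw [hG]
        intro h0
        rcases (Polynomial.comp_eq_zero_iff).1 h0 with h1 | ⟨-, h2⟩
        · exact hF0 h1
        · have := congrArg Polynomial.natDegree h2
          rw [hPdeg, Polynomial.natDegree_C] at this
          exact one_ne_zero this
      have hGeval : ∀ x y : ℂ, (G.map (Polynomial.evalRingHom x)).eval y =
          (F.map (Polynomial.evalRingHom x)).eval ((den : ℂ)⁻¹ * (y + num * x)) := by
        intro x y
        rw [hG, Polynomial.map_comp, Polynomial.eval_comp, hP]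
        simp
      have hplaceG : ∀ᶠ s in 𝓝[≠] (0 : ℂ),
          (G.map (Polynomial.evalRingHom (s ^ k)⁻¹)).eval (γ s * (s ^ M')⁻¹) = 0 := by
        filter_upwards [hplace, hγ', self_mem_nhdsWithin] with s hs hγs (hs0 : s ≠ 0)
        rw [hGeval]
        have e : (den : ℂ)⁻¹ * (γ s * (s ^ M')⁻¹ + num * (s ^ k)⁻¹) = Φ s * (s ^ k)⁻¹ := by
          rw [← hγs]
          simp [hU]
          field_simp
        rw [e]
        exact hs
      have hγalg : IsAlgebraic ℚ (γ 0) :=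
        isAlgebraic_leadCoeff_of_place G hG0 halgG hk M' hγan.continuousAt hplaceG
      -- non-resonance (Lindemann) and the transported slow-regime engine (file LXXIX)
      obtain ⟨z, hz⟩ := IsAlgClosed.exists_pow_nat_eq (2 * Real.pi * I : ℂ) (by omega : 0 < k)
      have hdir := not_resonant_of_isAlgebraic hγalg hγ0 hk (by omega : M' ≠ k) hz
      have hδan : AnalyticAt ℂ (fun s => (U 0 0 : ℂ) + (U 0 1 : ℂ) * Φ s) 0 :=
        analyticAt_const.add (analyticAt_const.mul hΦ)
      have hδ0 : (fun s => (U 0 0 : ℂ) + (U 0 1 : ℂ) * Φ s) 0 ≠ 0 := by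
        simp only [hU, hΦq, hqC]
        simp
        intro h0
        have h1 : (a' : ℂ) * den + b' * num = 0 := by
          have := congrArg (· * (den : ℂ)) h0
          simp only [zero_mul] at this
          rw [← this]
          field_simp
        have h2 : ((b' * num + a' * den : ℤ) : ℂ) = 1 := by exact_mod_cast hbez
        push_cast at h2
        have : (1 : ℂ) = 0 := by rw [← h2]; linear_combination h1
        exact one_ne_zero this
      have hδ : ∀ᶠ s in 𝓝[≠] (0 : ℂ), (U 0 0 : ℂ) * (s ^ k)⁻¹ + (U 0 1 : ℂ) *
          ((fun s => Φ s * (s ^ k)⁻¹) s) = (fun s => (U 0 0 : ℂ) + (U 0 1 : ℂ) * Φ s) s * (s ^ k)⁻¹ := by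
        filter_upwards [] with s
        ring
      exact unprojectedDense_transportedSlow hS hdim U V hUV hVU hM'1 hM'k hγan hδan hδ0 hγ' hδ
        ⟨z, hz, hdir⟩ L hψ hψ0 hgermX

/-- **Every unbounded place of a curve over `ℚ̄`, every fibre value: dense.**  `F` irreducible
containing no line (hypothesis `hnc`), with algebraic coefficients; a place `x₀ = s^{-k}`,
`x₁ = Φ(s)s^{-M}` (`k, M ≥ 1`, `Φ(0) ≠ 0`); a fibre value `ψ(s)s^L` (`ψ(0) ≠ 0`); `S` irreducible
closed of dimension `≤ 2` containing the germ.  Then `I(S ∩ Γ_exp) = I(S)`.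
[cite: MantovaMasser2023, §1 Further remarks, p. 5 (the question, open in general)] (new) -/
theorem unprojectedDense_branch_of_algebraicCurve {S : Set (Fin 2 ⊕ Fin 2 → ℂ)}
    (hS : IsIrreducibleClosed ℂ S) (hdim : zariskiDim ℂ S ≤ (2 : ℕ)) (hFirr : Irreducible F)
    (hnc : ∀ m₀ m₁ a : ℂ, m₁ ≠ 0 →
      ∃ x₀ : ℂ, (F.map (Polynomial.evalRingHom x₀)).eval ((a - m₀ * x₀) / m₁) ≠ 0)
    (halg : ∀ i j, IsAlgebraic ℚ ((F.coeff j).coeff i))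
    {k M : ℕ} (hk : 1 ≤ k) (hM : 1 ≤ M) {Φ : ℂ → ℂ} (hΦ : AnalyticAt ℂ Φ 0) (hΦ0 : Φ 0 ≠ 0)
    (hplace : ∀ᶠ s in 𝓝[≠] (0 : ℂ),
      (F.map (Polynomial.evalRingHom (s ^ k)⁻¹)).eval (Φ s * (s ^ M)⁻¹) = 0)
    (L : ℤ) {ψ : ℂ → ℂ} (hψ : AnalyticAt ℂ ψ 0) (hψ0 : ψ 0 ≠ 0)
    (hgerm : ∀ᶠ s in 𝓝[≠] (0 : ℂ),
      (Sum.elim ![(s ^ k)⁻¹, Φ s * (s ^ M)⁻¹] ![ψ s * s ^ L, Complex.exp (Φ s * (s ^ M)⁻¹)] :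
        Fin 2 ⊕ Fin 2 → ℂ) ∈ S) :
    UnprojectedDense S := by
  classical
  have hF0 : F ≠ 0 := hFirr.ne_zero
  have hθalg : IsAlgebraic ℚ (Φ 0) :=
    isAlgebraic_leadCoeff_of_place F hF0 halg hk M hΦ.continuousAt hplace
  obtain ⟨z, hz⟩ := IsAlgClosed.exists_pow_nat_eq (2 * Real.pi * I : ℂ) (by omega : 0 < k)
  rcases Nat.lt_trichotomy M k with hMk | hMk | hMk
  · -- slow regime: non-resonant by Lindemann
    exact unprojectedDense_branch_slow_of_not_resonant hS hdim hM hMk L hψ hψ0 hΦ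
      ⟨z, hz, not_resonant_of_isAlgebraic hθalg hΦ0 hk (ne_of_lt hMk) hz⟩ hgerm
  · -- equal orders
    subst hMk
    by_cases him : (Φ 0).im = 0
    · set a : ℝ := (Φ 0).re with ha
      have hΦa : Φ 0 = (a : ℂ) := Complex.ext (by simp [ha]) (by simp [him])
      by_cases hirr : Irrational a
      · exact unprojectedDense_branch_irrational hS hdim hM L hψ hψ0 hΦ hirr hΦa hgerm
      · obtain ⟨q, hq⟩ : ∃ q : ℚ, (q : ℝ) = a := by
          unfold Irrational at hirr
          push Not at hirr
          exact hirr
        have hΦq : Φ 0 = (q : ℂ) := by rw [hΦa, ← hq]; norm_cast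
        exact unprojectedDense_branch_rationalDirection F hS hdim hFirr hnc halg hM hΦ q hΦq hplace L hψ
          hψ0 hgerm
    · -- non-real direction: growth
      refine unprojectedDense_branch_poleFibre_of_exists_direction hS hdim hM hM L hψ hψ0 hΦ
        ⟨z, hz, ?_⟩ hgerm
      rw [hz]
      have : (Φ 0 * (2 * Real.pi * I)).re = -(2 * Real.pi) * (Φ 0).im := by
        simp [Complex.mul_re]; ring
      rw [this]
      exact mul_ne_zero (neg_ne_zero.2 (by positivity)) him
  · -- fast regime
    by_cases hL : L = 0
    · subst hL
      refine unprojectedDense_branch_of_not_resonant hS hdim hk hM hψ hψ0 rfl hΦ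
        ⟨z, hz, not_resonant_of_isAlgebraic hθalg hΦ0 hk (ne_of_gt hMk) hz⟩ ?_
      filter_upwards [hgerm] with s hs
      rwa [zpow_zero, mul_one] at hs
    · exact unprojectedDense_branch_poleFibre_fast hS hdim hk hMk hL hψ hψ0 hΦ hΦ0 hgerm

end AlgebraicBranch

end Summit.Schanuel.Schanuel.Theorems

end
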